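/-
Copyright (c) 2026. All rights reserved.
Released under Apache 2.0 license as described in the file LICENSE.
-/
import Mathlib
import HarnessLib

/-!
# Sequential limit for bounded differences

The core lemma: if f(x_n) - g(x_n) is bounded uniformly by ε along a sequence
x_n → c, and f, g are continuous at c, then f(c) - g(c) is bounded by ε.

This is used in the G decomposition limit argument for CombDescentStep.
-/

open Complex Real Set Filter Topology Metric
open scoped BigOperators Topology ComplexConjugate

noncomputable section

namespace EarlyAppointmentsSeqLimit

/-- The core limit lemma: bounded error on a sequence implies bounded error at limit.

If f and g are continuous at c, and ‖f(seq n) - g(seq n)‖ ≤ ε for all n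
along a sequence seq n → c, then ‖f(c) - g(c)‖ ≤ ε.
-/
theorem norm_diff_le_of_seq {f g : ℂ → ℂ} {c : ℂ} {ε : ℝ}
    (hf_cont : ContinuousAt f c)
    (hg_cont : ContinuousAt g c)
    (seq : ℕ → ℂ)
    (hseq : Tendsto seq atTop (nhds c))
    (hbound : ∀ n, ‖f (seq n) - g (seq n)‖ ≤ ε) :
    ‖f c - g c‖ ≤ ε := by
  -- f - g is continuous, so ‖(f - g)(seq n)‖ → ‖(f - g)(c)‖
  have hfg_cont : ContinuousAt (f - g) c := hf_cont.sub hg_cont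
  have hfg_tendsto : Tendsto (fun n => (f - g) (seq n)) atTop (nhds ((f - g) c)) :=
    hfg_cont.tendsto.comp hseq
  have hnorm_tendsto : Tendsto (fun n => ‖(f - g) (seq n)‖) atTop (nhds ‖(f - g) c‖) :=
    continuous_norm.continuousAt.tendsto.comp hfg_tendsto
  -- ‖f c - g c‖ = ‖(f - g) c‖
  have heq : ‖f c - g c‖ = ‖(f - g) c‖ := by simp [Pi.sub_apply]
  rw [heq]
  -- The limit of a bounded sequence is bounded by the same bound
  have hbound' : ∀ n, ‖(f - g) (seq n)‖ ≤ ε := by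
    intro n
    simp only [Pi.sub_apply]
    exact hbound n
  exact le_of_tendsto hnorm_tendsto (Filter.Eventually.of_forall hbound')

end EarlyAppointmentsSeqLimit

end
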